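import Literature.Analysis.FluidPDE.CorrectorFourierData
import HarnessLib

/-!
# Synthesis of the local solution of (3.2): smoothness, reality, Fourier dictionary

Analysis/FluidPDE proof file, eighth of the files discharging
`Literature.Analysis.FluidPDE.Torus.CheskidovLuo2022LocalExistence` (objects in
`CorrectorFourierDefs`, `CorrectorFourierDataDefs`). Under the hypotheses of the short-interval
Picard construction (`0 < θ ≤ 1`, background `u`, `R` jointly smooth on `[0, θ] × 𝕋^d` with
`div u = 0`, drift/stress coefficients bounded at order `2#d + 1` by `A`, `B`, and the two
threshold inequalities of `CorrectorFourierPicard` for the radius `ρ`), the coefficient field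
`c = solCoeff θ u R` and the synthesized fields satisfy:

* the package of Fourier-side properties of `c` (continuity, ball, every decay, divergence
  freedom, zero mode, conjugation symmetry, vanishing at `t ≤ 0`, the differentiated mild
  equation, coefficient families of every order; `CorrectorFourierPicard` … `…TimeRegularity`);
* the complex velocity components `Vₗ = velC θ u R l = ∑ₖ c(l,t,k) e_k` and the complex pressure
  `Q = presC θ u R` are jointly smooth on `[0, θ] × 𝕋^d` (`ScalarFourier.isSmoothSpaceTimeOn_torusSynth`;
  for the pressure, the family `-(2πi|k|²)⁻¹ ∑ₘ kₘ convFamilyₘ` agrees with `presCoeffField` on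
  `[0, θ]`), the `Vₗ` are **real** (conjugation symmetry of `c`), so `Vₗ = (velₗ : ℂ)` and the
  real fields `vel`, `pres` are jointly smooth;
* the Fourier dictionary at `t ∈ [0, θ]`: `𝓕(Vₗ) = cₗ`, `𝓕(∂ₜVₗ) = -4π²|k|²cₗ - (P G)ₗ`,
  `𝓕(∂ⱼVₗ) = 2πikⱼcₗ`, `𝓕(ΔVₗ) = -4π²|k|²cₗ`, `𝓕(uⱼ) = Uⱼ`, `𝓕(Rₗⱼ) = RHₗⱼ`, `𝓕(Q) = q̂`,
  products ↦ lattice convolutions (`ScalarFourier.mFourierCoeff_mul`).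

## References

* A. Cheskidov, X. Luo, arXiv:2009.06596, §3.1 (3.2). [`CheskidovLuo2022`]
* L. Grafakos, *Classical Fourier Analysis*, 3rd ed. (2014), Prop. 3.2.5, 3.2.6 (8), §3.3.1. [`Grafakos2014`]
-/

noncomputable section

open MeasureTheory Real Set Filter Topology UnitAddTorus

namespace Literature.Analysis.FluidPDE

namespace CorrectorFourier

open scoped ComplexConjugate ContDiff
open ScalarFourier
open FourierNS (HasDecay clamp)
open Literature.Analysis.FunctionSpaces.Torus (freqNormSq IsSmoothSpaceTimeOn IsSmooth)

variable {d : Type*} [Fintype d] [DecidableEq d]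
variable {θ : ℝ} {u : ℝ → UnitAddTorus d → EuclideanSpace ℝ d}
  {R : ℝ → UnitAddTorus d → d → EuclideanSpace ℝ d} {ρ A B : ℝ}

/-! ### The Fourier-side package of the solution coefficients -/

/-- **The Fourier-side properties of `c = solCoeff θ u R` on a short interval** (continuity in
time, the ball of the base order, every decay, Fourier divergence freedom, vanishing zero mode,
conjugation symmetry, vanishing at `t ≤ 0`, the differentiated mild equation on `[0, θ]`, and
coefficient families of every order starting at `c`), collected from `CorrectorFourierPicard`,
`…Regularity`, `…Symmetry`, `…TimeRegularity` for the data of `CorrectorFourierData`. [folklore] -/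
theorem solCoeff_spec (hθ : 0 < θ) (hθ1 : θ ≤ 1) (hu : IsSmoothSpaceTimeOn (Icc 0 θ) u)
    (hdiv : ∀ t ∈ Icc 0 θ, FunctionSpaces.Torus.IsDivFree (u t)) (hR : IsSmoothSpaceTimeOn (Icc 0 θ) R)
    (hρ : 0 ≤ ρ) (hA : 0 ≤ A) (hB : 0 ≤ B)
    (hUA : ∀ j t, HasDecay (latOrder d + 1) A (driftCoeff θ u j t))
    (hRB : ∀ i j t, HasDecay (latOrder d + 1) B (stressCoeff θ R i j t))
    (hS1 : (Real.exp 1 * (1 + 1 / (2 * Real.sqrt (4 * π ^ 2 * 1))) * Real.sqrt θ) *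
      (2 * Fintype.card d *
        (Fintype.card d * (2 ^ latOrder d * latMass d * (ρ * (2 * π * ρ) + ρ * (2 * π * ρ))) +
          Fintype.card d * (2 ^ latOrder d * latMass d * (A * (2 * π * ρ) + A * (2 * π * ρ))) +
          Fintype.card d * (2 ^ latOrder d * latMass d * (ρ * (2 * π * A) + ρ * (2 * π * A))) +
          Fintype.card d * (2 * π * B))) ≤ ρ)
    (hS2 : (Real.exp 1 * (1 + 1 / (2 * Real.sqrt (4 * π ^ 2 * 1))) * Real.sqrt θ) *
      (2 * Fintype.card d *
        (Fintype.card d * (2 ^ latOrder d * latMass d * (2 * π)) * (4 * ρ + 4 * A))) ≤ 1 / 2) :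
    (∀ l m, Continuous fun t => solCoeff θ u R l t m) ∧
    (∀ l t, HasDecay (latOrder d + 1) ρ (solCoeff θ u R l t)) ∧
    (∀ K : ℕ, ∃ C : ℝ, 0 ≤ C ∧ ∀ l t, HasDecay K C (solCoeff θ u R l t)) ∧
    (∀ t k, ∑ l, (k l : ℂ) * solCoeff θ u R l t k = 0) ∧
    (∀ l t, solCoeff θ u R l t 0 = 0) ∧
    (∀ l t k, solCoeff θ u R l t (-k) = conj (solCoeff θ u R l t k)) ∧
    (∀ l t, t ≤ 0 → ∀ k, solCoeff θ u R l t k = 0) ∧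
    (∀ l k, ∀ t ∈ Icc 0 θ, HasDerivWithinAt (fun s => solCoeff θ u R l s k)
      (-(heatRate 1 k : ℂ) * solCoeff θ u R l t k -
        projSym (fun j => driftCoeff θ u j t) (fun i j => stressCoeff θ R i j t)
          (fun j => solCoeff θ u R j t) l k) (Icc 0 θ) t) ∧
    (∀ n : ℕ, ∃ W : d → ℕ → ℝ → (d → ℤ) → ℂ, (∀ l, W l 0 = solCoeff θ u R l) ∧
      ∀ l, IsCoeffFamily θ n (W l)) := by
  have h := dataHyp hθ hθ1 hu hR
  obtain ⟨hcont, hball, htend, -, hlimball⟩ := h.iter_tendsto hρ hA hB hUA hRB hS1 hS2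
  have hUc : ∀ j t m, driftCoeff θ u j t (-m) = conj (driftCoeff θ u j t m) :=
    driftCoeff_neg_eq_conj θ u
  have hRc : ∀ i j t m, stressCoeff θ R i j t (-m) = conj (stressCoeff θ R i j t m) :=
    stressCoeff_neg_eq_conj θ R
  have hUdiv : ∀ t m, ∑ j, (m j : ℂ) * driftCoeff θ u j t m = 0 :=
    sum_intCast_mul_driftCoeff hθ.le hu hdiv
  refine ⟨h.continuous_picardLim hρ hA hB hUA hRB hS1 hS2, hlimball,
    h.hasDecay_picardLim_all hρ hA hUA hball htend, ?_, ?_, ?_, ?_, ?_, ?_⟩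
  · exact picardLim_divFree (h.iter_divFree hUA hcont hball) htend
  · exact picardLim_zero_freq (h.iter_zero_freq hUA hUdiv hcont hball) htend
  · exact picardLim_conjSymm (iter_conjSymm hUc hRc) htend
  · exact fun l t ht k => h.picardLim_of_nonpos hρ hA hB hUA hRB hS1 hS2 l ht k
  · exact fun l k t ht => h.hasDerivWithinAt_picardLim hρ hA hB hUA hRB hS1 hS2 l k ht
  · intro n
    exact h.exists_coeffFamily hρ hA hB hUA hRB hS1 hS2 (fun n j => isCoeffFamily_driftFam hθ hu n j)
      (fun n i j => isCoeffFamily_stressFam hθ hR n i j) (fun j t ht => driftFam_zero_of_mem u j ht)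
      (fun i j t ht => stressFam_zero_of_mem R i j ht) n

/-! ### Reality of conjugate-symmetric Fourier series -/

omit [DecidableEq d] in
/-- **A Fourier series with conjugate-symmetric coefficients is real**:
`conj (∑ₖ cₖ e_k(x)) = ∑ₖ cₖ e_k(x)` when `c₋ₖ = conj cₖ` (reindex `k ↦ -k`, `conj e_k = e_{-k}`;
no summability is needed). [folklore] -/
theorem conj_tsum_mul_mFourier {c : (d → ℤ) → ℂ} (hconj : ∀ k, c (-k) = conj (c k)) (x : UnitAddTorus d) :
    conj (∑' k, c k * mFourier k x) = ∑' k, c k * mFourier k x := by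
  rw [Complex.conj_tsum, ← (Equiv.neg (d → ℤ)).tsum_eq]
  refine tsum_congr fun k => ?_
  simp only [Equiv.neg_apply, map_mul, hconj k, mFourier_neg, Complex.conj_conj]

omit [Fintype d] [DecidableEq d] in
/-- A complex number fixed by conjugation is the cast of its real part. [folklore] -/
theorem eq_ofReal_re_of_conj_eq {z : ℂ} (h : conj z = z) : z = ((z.re : ℝ) : ℂ) :=
  (Complex.conj_eq_iff_re.1 h).symm

/-! ### The pressure family -/

omit [DecidableEq d] in
/-- The pressure symbol `-(2πi|k|²)⁻¹` is bounded by `1` (it vanishes at `k = 0`, and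
`|k|² ≥ 1` otherwise). [folklore] -/
theorem norm_presSymbol_le (k : d → ℤ) :
    ‖(-(1 : ℂ)) / (2 * π * Complex.I * (freqNormSq k : ℂ))‖ ≤ 1 * (1 + ‖k‖) ^ 0 := by
  rw [pow_zero, mul_one, norm_div, norm_neg, norm_one]
  rcases eq_or_lt_of_le (FunctionSpaces.Torus.freqNormSq_nonneg k) with h0 | hpos
  · rw [← h0]; simp
  · have h1 : 1 ≤ freqNormSq k := by
      have hk : k ≠ 0 := by
        rintro rfl
        simp [FunctionSpaces.Torus.freqNormSq] at hpos
      obtain ⟨i, hi⟩ := Function.ne_iff.1 hk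
      have h2 : (1 : ℤ) ≤ |k i| := Int.one_le_abs hi
      have h3 : (1 : ℝ) ≤ |(k i : ℝ)| := by exact_mod_cast h2
      have h4 : (1 : ℝ) ≤ (k i : ℝ) ^ 2 := by nlinarith [sq_abs (k i : ℝ), abs_nonneg (k i : ℝ)]
      exact h4.trans (sq_apply_le_freqNormSq k i)
    have hn : ‖(2 * π * Complex.I * (freqNormSq k : ℂ) : ℂ)‖ = 2 * π * freqNormSq k := by
      rw [norm_mul, norm_mul, norm_mul, Complex.norm_I, Complex.norm_real, Complex.norm_two,
        Real.norm_of_nonneg Real.pi_pos.le, mul_one, Complex.norm_real, Real.norm_of_nonneg hpos.le]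
    rw [hn, div_le_one (by positivity)]
    nlinarith [Real.two_le_pi]

omit [DecidableEq d] in
/-- The coordinate symbol `kₘ` has linear growth. [folklore] -/
theorem norm_intCast_apply_le (m : d) (k : d → ℤ) : ‖((k m : ℤ) : ℂ)‖ ≤ 1 * (1 + ‖k‖) ^ 1 := by
  rw [Complex.norm_intCast, one_mul, pow_one]
  have h := abs_apply_le_norm k m
  have h' : |((k m : ℤ) : ℝ)| ≤ ‖k‖ := by exact_mod_cast h
  linarith [norm_nonneg k]

/-- **The pressure coefficients start a coefficient family of every order.** With `W` the
velocity families of order `n`, the family `-(2πi|k|²)⁻¹ ∑ₘ kₘ convFamilyₘ` is a family of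
order `n` whose zeroth member agrees with `presCoeffField θ u R` on `[0, θ]`; replacing the
zeroth member by `presCoeffField θ u R` itself keeps it a family (all clauses of
`IsCoeffFamily` live on `[0, θ]`). [folklore] -/
theorem exists_presFamily (hθ : 0 < θ) (hu : IsSmoothSpaceTimeOn (Icc 0 θ) u)
    (hR : IsSmoothSpaceTimeOn (Icc 0 θ) R) {n : ℕ} {W : d → ℕ → ℝ → (d → ℤ) → ℂ}
    (hW0 : ∀ l, W l 0 = solCoeff θ u R l) (hW : ∀ l, IsCoeffFamily θ n (W l)) :
    ∃ Q : ℕ → ℝ → (d → ℤ) → ℂ, Q 0 = presCoeffField θ u R ∧ IsCoeffFamily θ n Q := by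
  have hUFf : ∀ j, IsCoeffFamily θ n (driftFam θ u j) := fun j => isCoeffFamily_driftFam hθ hu n j
  have hRFf : ∀ i j, IsCoeffFamily θ n (stressFam θ R i j) := fun i j => isCoeffFamily_stressFam hθ hR n i j
  -- the candidate family
  set Q₀ : ℕ → ℝ → (d → ℤ) → ℂ := fun i t k =>
    (-(1 : ℂ)) / (2 * π * Complex.I * (freqNormSq k : ℂ)) *
      ∑ m, (k m : ℂ) * convFamily (driftFam θ u) (stressFam θ R) W m i t k with hQ₀
  have hQ₀f : IsCoeffFamily θ n Q₀ :=
    (IsCoeffFamily.finset_sum _ fun m _ =>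
      (IsCoeffFamily.convFamily hθ hUFf hRFf hW m).symbol (σ := fun k => (k m : ℂ)) (g := 1)
        zero_le_one (norm_intCast_apply_le m)).symbol (g := 0) zero_le_one norm_presSymbol_le
  -- agreement with `presCoeffField` on `[0, θ]`
  have hagree : ∀ t ∈ Icc 0 θ, ∀ k, Q₀ 0 t k = presCoeffField θ u R t k := by
    intro t ht k
    simp only [hQ₀, convFamily_zero, presCoeffField_apply, presCoef_apply, hW0]
    have hU' : (fun j => driftFam θ u j 0 t) = fun j => driftCoeff θ u j t :=
      funext fun j => driftFam_zero_of_mem u j ht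
    have hR' : (fun i j => stressFam θ R i j 0 t) = fun i j => stressCoeff θ R i j t := by
      funext i j; exact stressFam_zero_of_mem R i j ht
    rw [hU', hR']
    ring
  -- replace the zeroth member
  refine ⟨fun i => if i = 0 then presCoeffField θ u R else Q₀ i, by simp, ?_⟩
  refine ⟨fun i hi K => ?_, fun i hi m => ?_, fun i hi m t ht => ?_⟩
  · obtain ⟨C, hC⟩ := hQ₀f.decay i hi K
    refine ⟨C, fun t ht m => ?_⟩
    split_ifs with h0
    · subst h0; rw [← hagree t ht m]; exact hC t ht m
    · exact hC t ht m
  · split_ifs with h0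
    · subst h0
      exact (hQ₀f.cont 0 hi m).congr fun t ht => (hagree t ht m).symm
    · exact hQ₀f.cont i hi m
  · have hd := hQ₀f.deriv i hi m t ht
    have hne : i + 1 ≠ 0 := Nat.succ_ne_zero i
    simp only [hne, if_false]
    split_ifs with h0
    · subst h0
      exact hd.congr (fun s hs => (hagree s hs m).symm) (hagree t ht m).symm
    · exact hd

/-! ### Smoothness and reality of the synthesized fields; the dictionary -/

/-- **The synthesized fields of the local solution**: under the short-interval hypotheses,
the complex velocity components `Vₗ = velC θ u R l` and the complex pressure `Q = presC θ u R`
are jointly smooth on `[0, θ] × 𝕋^d`; the `Vₗ` are real, `Vₗ = (velₗ : ℂ)`, and so is `Q`,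
`Q = (pres : ℂ)`; the real velocity `vel θ u R` and pressure `pres θ u R` are jointly smooth;
and the Fourier coefficients are `𝓕(Vₗ(t)) = c(l,t,·)` (all `t`),
`𝓕(∂ₜVₗ(t)) = -4π²|k|² cₗ - (P G)ₗ` and `𝓕(Q(t)) = q̂(t,·)` for `t ∈ [0, θ]`
(Grafakos 2014, §3.3.1, Prop. 3.2.7). [folklore] -/
theorem synth_spec (hθ : 0 < θ) (hθ1 : θ ≤ 1) (hu : IsSmoothSpaceTimeOn (Icc 0 θ) u)
    (hdiv : ∀ t ∈ Icc 0 θ, FunctionSpaces.Torus.IsDivFree (u t)) (hR : IsSmoothSpaceTimeOn (Icc 0 θ) R)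
    (hρ : 0 ≤ ρ) (hA : 0 ≤ A) (hB : 0 ≤ B)
    (hUA : ∀ j t, HasDecay (latOrder d + 1) A (driftCoeff θ u j t))
    (hRB : ∀ i j t, HasDecay (latOrder d + 1) B (stressCoeff θ R i j t))
    (hS1 : (Real.exp 1 * (1 + 1 / (2 * Real.sqrt (4 * π ^ 2 * 1))) * Real.sqrt θ) *
      (2 * Fintype.card d *
        (Fintype.card d * (2 ^ latOrder d * latMass d * (ρ * (2 * π * ρ) + ρ * (2 * π * ρ))) +
          Fintype.card d * (2 ^ latOrder d * latMass d * (A * (2 * π * ρ) + A * (2 * π * ρ))) +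
          Fintype.card d * (2 ^ latOrder d * latMass d * (ρ * (2 * π * A) + ρ * (2 * π * A))) +
          Fintype.card d * (2 * π * B))) ≤ ρ)
    (hS2 : (Real.exp 1 * (1 + 1 / (2 * Real.sqrt (4 * π ^ 2 * 1))) * Real.sqrt θ) *
      (2 * Fintype.card d *
        (Fintype.card d * (2 ^ latOrder d * latMass d * (2 * π)) * (4 * ρ + 4 * A))) ≤ 1 / 2) :
    (∀ l, IsSmoothSpaceTimeOn (Icc 0 θ) (velC θ u R l)) ∧
    IsSmoothSpaceTimeOn (Icc 0 θ) (presC θ u R) ∧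
    (∀ l t x, velC θ u R l t x = ((vel θ u R t x l : ℝ) : ℂ)) ∧
    (∀ t x, presC θ u R t x = ((pres θ u R t x : ℝ) : ℂ)) ∧
    IsSmoothSpaceTimeOn (Icc 0 θ) (vel θ u R) ∧ IsSmoothSpaceTimeOn (Icc 0 θ) (pres θ u R) ∧
    (∀ l t k, mFourierCoeff (velC θ u R l t) k = solCoeff θ u R l t k) ∧
    (∀ l, ∀ t ∈ Icc 0 θ, ∀ k, mFourierCoeff (FunctionSpaces.Torus.timeDerivWithin (Icc 0 θ) (velC θ u R l) t) k =
      -(heatRate 1 k : ℂ) * solCoeff θ u R l t k -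
        projSym (fun j => driftCoeff θ u j t) (fun i j => stressCoeff θ R i j t)
          (fun j => solCoeff θ u R j t) l k) ∧
    (∀ t ∈ Icc 0 θ, ∀ k, mFourierCoeff (presC θ u R t) k = presCoeffField θ u R t k) := by
  obtain ⟨hcc, hball, hdecay, hdivF, hzero, hconj, hnonpos, hderiv, hfam⟩ :=
    solCoeff_spec hθ hθ1 hu hdiv hR hρ hA hB hUA hRB hS1 hS2
  have hUS : UniqueDiffOn ℝ (Icc 0 θ) := uniqueDiffOn_Icc hθ
  -- summability of the coefficients at every time
  have hsum : ∀ l t, Summable fun k => ‖solCoeff θ u R l t k‖ := fun l t =>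
    summable_norm_of_hasDecay (Nat.le_succ _) (hball l t)
  -- smoothness of the complex fields
  have hV : ∀ l, IsSmoothSpaceTimeOn (Icc 0 θ) (velC θ u R l) := fun l =>
    isSmoothSpaceTimeOn_torusSynth hθ fun n => by
      obtain ⟨W, hW0, hW⟩ := hfam n
      exact ⟨W l, hW0 l, hW l⟩
  have hQ : IsSmoothSpaceTimeOn (Icc 0 θ) (presC θ u R) :=
    isSmoothSpaceTimeOn_torusSynth hθ fun n => by
      obtain ⟨W, hW0, hW⟩ := hfam n
      exact exists_presFamily hθ hu hR hW0 hW
  -- reality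
  have hVreal : ∀ l t x, velC θ u R l t x = ((vel θ u R t x l : ℝ) : ℂ) := by
    intro l t x
    rw [vel_apply]
    refine eq_ofReal_re_of_conj_eq ?_
    change conj (∑' k, solCoeff θ u R l t k * mFourier k x) = ∑' k, solCoeff θ u R l t k * mFourier k x
    exact conj_tsum_mul_mFourier (hconj l t) x
  have hpresconj : ∀ t k, presCoeffField θ u R t (-k) = conj (presCoeffField θ u R t k) := by
    intro t k
    have hG : ∀ m, convSym (fun j => driftCoeff θ u j t) (fun i j => stressCoeff θ R i j t)
        (fun j => solCoeff θ u R j t) m (-k) =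
        conj (convSym (fun j => driftCoeff θ u j t) (fun i j => stressCoeff θ R i j t)
          (fun j => solCoeff θ u R j t) m k) := fun m =>
      convSym_neg_eq_conj (fun j m' => driftCoeff_neg_eq_conj θ u j t m')
        (fun i j m' => stressCoeff_neg_eq_conj θ R i j t m') (fun j m' => hconj j t m') m k
    have hD : conj (2 * π * Complex.I * (freqNormSq k : ℂ)) = -(2 * π * Complex.I * (freqNormSq k : ℂ)) := by
      rw [map_mul, map_mul, map_mul, Complex.conj_ofReal, Complex.conj_ofReal, Complex.conj_I, map_ofNat]
      ring
    rw [presCoeffField_apply, presCoeffField_apply, presCoef_apply, presCoef_apply,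
      FunctionSpaces.Torus.freqNormSq_neg, map_div₀, map_neg, hD, map_sum]
    have hnum : ∑ m, ((-k) m : ℂ) * convSym (fun j => driftCoeff θ u j t) (fun i j => stressCoeff θ R i j t)
        (fun j => solCoeff θ u R j t) m (-k) =
        -∑ m, conj ((k m : ℂ) * convSym (fun j => driftCoeff θ u j t) (fun i j => stressCoeff θ R i j t)
          (fun j => solCoeff θ u R j t) m k) := by
      rw [← Finset.sum_neg_distrib]
      refine Finset.sum_congr rfl fun m _ => ?_
      rw [Pi.neg_apply, Int.cast_neg, hG m, map_mul, map_intCast]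
      ring
    rw [hnum, neg_neg, neg_div_neg_eq]
  have hQreal : ∀ t x, presC θ u R t x = ((pres θ u R t x : ℝ) : ℂ) := by
    intro t x
    rw [pres_apply]
    refine eq_ofReal_re_of_conj_eq ?_
    change conj (∑' k, presCoeffField θ u R t k * mFourier k x) = ∑' k, presCoeffField θ u R t k * mFourier k x
    exact conj_tsum_mul_mFourier (hpresconj t) x
  -- smoothness of the real fields
  have hvel : IsSmoothSpaceTimeOn (Icc 0 θ) (vel θ u R) := by
    change ContDiffOn ℝ ∞ (FunctionSpaces.Torus.stLift (vel θ u R)) (Icc 0 θ ×ˢ univ)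
    rw [contDiffOn_euclidean]
    intro l
    exact (hV l).clm_comp Complex.reCLM
  have hpres : IsSmoothSpaceTimeOn (Icc 0 θ) (pres θ u R) := hQ.clm_comp Complex.reCLM
  -- the dictionary
  have hcV : ∀ l t k, mFourierCoeff (velC θ u R l t) k = solCoeff θ u R l t k := fun l t k =>
    mFourierCoeff_tsum_mul_mFourier (hsum l t) k
  have hcVt : ∀ l, ∀ t ∈ Icc 0 θ, ∀ k,
      mFourierCoeff (FunctionSpaces.Torus.timeDerivWithin (Icc 0 θ) (velC θ u R l) t) k =
      -(heatRate 1 k : ℂ) * solCoeff θ u R l t k -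
        projSym (fun j => driftCoeff θ u j t) (fun i j => stressCoeff θ R i j t)
          (fun j => solCoeff θ u R j t) l k := by
    intro l t ht k
    obtain ⟨W, hW0, hW⟩ := hfam 1
    have hW1 : ∀ m, W l 1 t m = -(heatRate 1 m : ℂ) * solCoeff θ u R l t m -
        projSym (fun j => driftCoeff θ u j t) (fun i j => stressCoeff θ R i j t)
          (fun j => solCoeff θ u R j t) l m := by
      intro m
      have h1 := (hW l).deriv 0 (by norm_num) m t ht
      rw [hW0] at h1
      exact (h1.derivWithin (hUS t ht)).symm.trans ((hderiv l m t ht).derivWithin (hUS t ht))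
    have hdt : ∀ x, FunctionSpaces.Torus.timeDerivWithin (Icc 0 θ) (velC θ u R l) t x = torusSynth (W l 1) t x := by
      intro x
      have := timeDerivWithin_torusSynth hθ (hW l) ht x
      rwa [hW0] at this
    obtain ⟨C1, -, hC1⟩ := (hW l).decay_nonneg le_rfl (latOrder d)
    have hsum1 : Summable fun m => ‖W l 1 t m‖ := summable_norm_of_hasDecay le_rfl (hC1 t ht)
    have hfun : FunctionSpaces.Torus.timeDerivWithin (Icc 0 θ) (velC θ u R l) t =
        fun x => ∑' m, W l 1 t m * mFourier m x := funext hdt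
    rw [hfun, mFourierCoeff_tsum_mul_mFourier hsum1 k, hW1 k]
  have hcQ : ∀ t ∈ Icc 0 θ, ∀ k, mFourierCoeff (presC θ u R t) k = presCoeffField θ u R t k := by
    intro t ht k
    obtain ⟨W, hW0, hW⟩ := hfam 0
    obtain ⟨Qf, hQ0, hQf⟩ := exists_presFamily hθ hu hR hW0 hW
    obtain ⟨C0, -, hC0⟩ := hQf.decay_nonneg le_rfl (latOrder d)
    have hsumQ : Summable fun m => ‖presCoeffField θ u R t m‖ := by
      have := summable_norm_of_hasDecay le_rfl (hC0 t ht)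
      rwa [hQ0] at this
    exact mFourierCoeff_tsum_mul_mFourier hsumQ k
  exact ⟨hV, hQ, hVreal, hQreal, hvel, hpres, hcV, hcVt, hcQ⟩

end CorrectorFourier

end Literature.Analysis.FluidPDE

end
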